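import Summits.Ventures.HodgeRepro.CMType

/-!
# Degree 10: a level-3 indecomposable `(eq2)`-family with six distinct corners (ROUTE.md §3.6 (iii))

Blind re-derivation cell `pub-hodge-repro`, seat `typer` (gen 5).  Continues `CMType.lean`.

ROUTE.md §3.6 classifies the `(eq2)`-multisets `{T₁, …, T_{2p}}` of CM types (every embedding in exactly
`p` of them, i.e. the sign vectors sum to zero) by indecomposability: a multiset with a proper non-empty
zero-sum sub-multiset reduces to smaller ones, so only INDECOMPOSABLE multisets need a closer.  In
degrees 6 and 8 the indecomposable ones are the conjugate pairs, the rank-four faces and (degree 8)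
one 6-multiset with a repeated corner (p4 g3 `Decomp6` / `Decomp8`); §3.6 (iii) asserts that in degree
`≥ 10` level-3 (`p = 3`) indecomposable families with PAIRWISE DISTINCT corners exist, so that no
closer restricted to `p = 2` reaches S4.  This file exhibits one in degree 10 and checks it in the
kernel: the cyclic group `C₁₀` with conjugation `5` and six CM types

`{5,6,7,8,9}, {4,5,6,7,8}, {1,2,3,5,9}, {0,2,3,6,9}, {0,1,3,4,7}, {0,1,2,4,8}` (exponents of the
generator), pairwise distinct, every embedding in exactly three of them (`SumP 3`), no two conjugate
(no zero-sum 2-subfamily), no 4-subfamily with every embedding in exactly two of its members (no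
zero-sum 4-subfamily; zero-sum subfamilies have even size, so these two conditions are
indecomposability).  The count behind the lead's §3.6 — 1184 such 6-multisets in degree 10, 864 with
six distinct corners in two `B₅`-orbits of sizes 480 and 384, 320 with a repeated corner — is
reproduced independently by proofs/typer-g5/witness10.py (Python; not kernel).
-/

set_option autoImplicit false

open Finset
open scoped Pointwise

namespace HodgeRepro

/-- The cyclic group of order 10 (Galois group of a cyclic CM field of degree 10). -/
abbrev C10 := Multiplicative (ZMod 10)

/-- Complex conjugation of `C₁₀`: the element of order 2. -/
def cc_C10 : C10 := Multiplicative.ofAdd 5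

/-- `cc_C10` is a central involution. -/
theorem cc_C10_isComplexConj : IsComplexConj cc_C10 := by decide

/-- `SumP p T`: every embedding lies in exactly `p` of the corners `T i` (`p = 2` is
`FaceReduce.SumTwo`; `p = 3` is the level-3 condition of ROUTE.md §3.6). -/
def SumP {G : Type*} [DecidableEq G] {ι : Type*} [Fintype ι] (p : ℕ) (T : ι → Finset G) : Prop :=
  ∀ x : G, (univ.filter fun i => x ∈ T i).card = p

/-- `SumP` is decidable on a finite group. -/
instance {G : Type*} [DecidableEq G] [Fintype G] {ι : Type*} [Fintype ι] (p : ℕ) (T : ι → Finset G) :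
    Decidable (SumP p T) := by
  unfold SumP; infer_instance

/-- The six corners of the degree-10 witness (exponents of the generator of `C₁₀`). -/
def level3Witness : Fin 6 → Finset C10 :=
  ![{Multiplicative.ofAdd 5, Multiplicative.ofAdd 6, Multiplicative.ofAdd 7, Multiplicative.ofAdd 8,
      Multiplicative.ofAdd 9},
    {Multiplicative.ofAdd 4, Multiplicative.ofAdd 5, Multiplicative.ofAdd 6, Multiplicative.ofAdd 7,
      Multiplicative.ofAdd 8},
    {Multiplicative.ofAdd 1, Multiplicative.ofAdd 2, Multiplicative.ofAdd 3, Multiplicative.ofAdd 5,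
      Multiplicative.ofAdd 9},
    {Multiplicative.ofAdd 0, Multiplicative.ofAdd 2, Multiplicative.ofAdd 3, Multiplicative.ofAdd 6,
      Multiplicative.ofAdd 9},
    {Multiplicative.ofAdd 0, Multiplicative.ofAdd 1, Multiplicative.ofAdd 3, Multiplicative.ofAdd 4,
      Multiplicative.ofAdd 7},
    {Multiplicative.ofAdd 0, Multiplicative.ofAdd 1, Multiplicative.ofAdd 2, Multiplicative.ofAdd 4,
      Multiplicative.ofAdd 8}]

/-- Every corner of the witness is a CM type of `(C₁₀, 5)`. -/
theorem level3Witness_isCMType : ∀ i, IsCMType cc_C10 (level3Witness i) := by decide +kernel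

/-- The six corners are pairwise distinct. -/
theorem level3Witness_injective : Function.Injective level3Witness := by decide +kernel

/-- Every embedding lies in exactly three corners (level 3, `(eq2)` with `p = 3`). -/
theorem level3Witness_sumThree : SumP 3 level3Witness := by decide +kernel

/-- No two corners are conjugate (no zero-sum 2-subfamily). -/
theorem level3Witness_noConj : ∀ i j : Fin 6, level3Witness j ≠ cc_C10 • level3Witness i := by
  decide +kernel

/-- No 4-subfamily is zero-sum (no four corners with every embedding in exactly two of them). -/
theorem level3Witness_noSumTwoSub :
    ∀ S : Finset (Fin 6), S.card = 4 →
      ¬ ∀ x : C10, (S.filter fun i => x ∈ level3Witness i).card = 2 := by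
  decide +kernel

/-- **ROUTE.md §3.6 (iii) in degree 10**: there is a level-3 `(eq2)`-family of six pairwise distinct
CM types of `(C₁₀, 5)` with no conjugate pair and no zero-sum 4-subfamily — an indecomposable
level-3 class with pairwise distinct corners, which no `p = 2` mechanism reaches. -/
theorem exists_level3_indecomposable_C10 :
    ∃ T : Fin 6 → Finset C10, (∀ i, IsCMType cc_C10 (T i)) ∧ Function.Injective T ∧ SumP 3 T ∧
      (∀ i j : Fin 6, T j ≠ cc_C10 • T i) ∧
      ∀ S : Finset (Fin 6), S.card = 4 → ¬ ∀ x : C10, (S.filter fun i => x ∈ T i).card = 2 :=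
  ⟨level3Witness, level3Witness_isCMType, level3Witness_injective, level3Witness_sumThree,
    level3Witness_noConj, level3Witness_noSumTwoSub⟩

end HodgeRepro
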